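/-
Copyright: lit-balaban READER/TYPER seat r18 (gen 30).  Statement-level skeleton of a published paper; no proof claims beyond what the kernel
checks below.
-/
import Literature.MathematicalPhysics.QuantumFieldTheory.BalabanImbrieJaffe1984to88.BIJ88CurlyDkLocHolderTorus
import Literature.MathematicalPhysics.QuantumFieldTheory.BalabanImbrieJaffe1984to88.BIJ88CurlyDkLocCloseTorus

/-!
# `BalabanImbrieJaffe1984to88.BIJ88CurlyDkLocPiCloseTorus` — T. Bałaban, J. Imbrie, A. Jaffe, *Effective action and cluster properties of the
abelian Higgs model*, Commun. Math. Phys. **114** (1988) 257–315 [BalabanImbrieJaffe1988], Sect. 2 p. 261 [PDF 5]: the third clause of the (2.13)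
sentence, *"and 𝒟_{k,loc} is close to 𝒟_k, see (5.4.3) below"*, PROVED IN KERNEL FORM FOR THE (2.12) PROPAGATOR LOCALIZED WITH PRINT'S SMOOTH-IN-`b`
CUTOFF — r18 g30's fork `𝒟^Π_{k,loc} = dkLocKerPi` — against p11's (I.4.4.4) propagator `𝒟_k = DkE P η_k^d L^k k` on the tori of the series:
`|𝒟_k(b,b″) − 𝒟^Π_{k,loc}(b,b″)| ≤ c₀·e^{−c·ρ_k}·e^{−δ′·dist_k(b,b″)}` beyond a threshold, for every radius schedule `ρ` positive and non-increasing
along `j < k` (the printed `r(e_j)` is, for `d ≤ 4`), with ONE set of constants for every torus (`P.d = d`, `P.L = L`) and every step, from `(d, L)`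
only and with NO hypothesis.

statement-level skeleton of published theorems with citation tags; proofs where landed; nothing here is a claim about the Yang–Mills mass gap

PDF held: `paper:balaban1988-cmp114-bij-abelian-higgs-effective-action` (journal page = PDF page + 256), p. 260–261 [PDF 4–5] (text layer
`p0005.txt` re-read this session 2026-08-23); p. 282 [PDF 26]: (5.4.3) and the unnumbered `w′₁`-display following it (the use of the clause).

CITATION HEADER (lean-in-tree rule).  Part of the lit-balaban TYPED SKELETON (HOME `run/shared/lean/pub/lit-balaban/`), READER/TYPER seat r18 =
the C2 §§1–4 fold owner (unit `lit-balaban-r18`, literature-prover-lit-balaban-r18-g30-0; TAKING #2 line HOME/STATUS.md 2026-08-23T23:24Z).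
Companion of r18 g30's `BIJ88CurlyDkLocHolderTorus` (the value / derivative / Hölder members of (2.13) and the finite range of the fork), supplying
its HONEST SCOPE (iii): the closeness clause for the same fork.  Rows of `HOME/lit-balaban-r18/ROWS-C2.md`: **C2.Eq2.13** and the DEF row
**C2.Eq2.12** — cells only, heads UNCHANGED (the head of C2.Eq2.13 is p08's hence-steps; the closeness for the object of record `dkLocKer` is r18
g10's `BIJ88CurlyDkLocCloseTorus`, whose architecture this file repeats verbatim with `H^Π_{j,loc}` in place of `H_{j,loc}`).  Decls used BY NAME
(nothing restated, nothing re-proved): r18 g30 `BIJ88CurlyDkLocHolderTorus.dkLocKerPi`/`termKerPi`/`dkLocKerPi_eq_sum`/`termKerPi_eq_sum`/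
`abs_hlKerPi_le_abs`; r18 g21 `BIJ88HkLocHolderTorus.hlKerPi`/`zetaPi`/`hlKerPi_apply`/`zetaPi_nonneg`/`zetaPi_le_one`/`zetaPi_eq_one_of_le`/
`exists_holderBounds_allTori`; r18 g10/g11 `BIJ88CurlyDkLocCloseTorus.abs_cKer_sub_clKer_ambient_le`/`cSide_of_cloc_estimates`/`rSched_pos_of_le`/
`rSched_anti` and `BIJ88CurlyDkLocTorus.hKer`/`cKer`/`clKer`/`kdist`/`rSched`/`cKer_ambient_eq`/`clKer_ambient_eq_apply`; p08 `BIJ85CurlyDkDecayTorus.dkKernel_eq_sum`,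
`BIJ88CurlyDkLocGradTerm.abs_triple_le₂`, `BIJ88CurlyDkLocDecayTorus.abs_sum_scales_le`; p09 `BIJ88ClocEstimatesTorus.cloc_estimates`;
`BIJ88Ineq217Ineq722Torus.ofLp_HkE_single`.

THE PRINTED TEXT (p. 261 [PDF 5], verbatim).  *"This propagator derives its regularity and decay from that of C^{(j)}_{loc} and H_{k,loc}. Thus
|(𝒟_{k,loc}f)(b)| ≦ ce^{−c dist(supp f, b)}‖f‖_∞ (2.13) and similarly for derivatives of 𝒟_{k,loc} and Hölder derivatives of order less than 2.
Furthermore, 𝒟_{k,loc}(b₁,b₂) = 0 for dist(b₁,b₂) ≧ ½r(e_k), and 𝒟_{k,loc} is close to 𝒟_k, see (5.4.3) below."*; p. 260 (2.1) *"ζ_k(b,b′) = 0, if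
dist(b,b′) ≧ ⅛r(e_k), 1, if dist(b,b′) ≦ (1/16)r(e_k), … such that ζ_k is a smooth function of b"*, (2.4) *"H_{k,loc}(b,b′) = ζ_k(b,b′)H_k(b,b′)"*,
(2.7) *"|H_{k,loc}(b,b′) − H_k(b,b′)| ≦ e^{−cr(e_k)}e^{−c dist(b,b′)}"*; p. 261 *"We have estimates analogous to (2.5)–(2.7) for C^{(k)}_{loc}"*.

THE READING (kind «model instance with a print-faithful cutoff»; conventions of the torus files, nothing new).  `𝒟_k(b,b″) =
Σ_{j<k}Σ_{b₁,b₂}H_j(b,b₁)C^{(j),L^jη}(b₁,b₂)H_j(b″,b₂)` (p08's `dkKernel_eq_sum`, kernels `hKer`/`cKer` at the weights `(η_k^d, L^k)`); the fork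
`𝒟^Π_{k,loc}(b,b″)` = the same with `H^Π_{j,loc} = ζ^Π_jH_j` (`hlKerPi`, radii `ρ_j/16 < ρ_j/8`) and `C^{(j),L^jη}_{loc}` (radius `ρ_j/4`, `clKer`).  Per
scale `HCH − H_lC_lH_l = (H − H_l)CH + H_l(C − C_l)H + H_lC_l(H − H_l)`; the small factors: `H_j − H^Π_{j,loc} = (1 − ζ^Π_j)H_j` VANISHES within
`ρ_j/16` (gen 21's `zetaPi_eq_one_of_le`) and `0 ≤ ζ^Π_j ≤ 1`, hence `|H_j − H^Π_{j,loc}| ≤ Me^{−(δ/2)(ρ_j/16)}e^{−(δ/2)dist}` ((2.7) for this object,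
`abs_hKer_sub_hlKerPi_le`), and `|C^{(j)} − C^{(j)}_{loc}| ≤ M_Ce^{−(δ_C/4)ρ_j}e^{−δ_C|b₁−b₂|}` (p09's (2.7)-analogue, rescaled — r18 g10's
`abs_cKer_sub_clKer_ambient_le`); each product is p08's two-kernel estimate `abs_triple_le₂`, the scale sum p08's `abs_sum_scales_le`, and
`e^{−cρ_j} ≤ e^{−cρ_k}` along a non-increasing schedule.

WHAT IS PROVED (kernel-checked; theorems only; 0 `sorry`; no new definition, no named fact; standard axioms):
* §1 `abs_hKer_sub_hlKerPi_le` — (2.7) for `H^Π_{j,loc} = ζ^Π_jH_j` from the sup member of (I.7.2.2) for `H_j`.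
* §2 `dk_sub_dkLocPi_eq_sum` (the difference as the scale sum), `abs_diffTermPi_le` (the scale-`j` difference term via the three telescoped
  products) and **`abs_dk_sub_dkLocPi_le`**: for `dist_k(b,b″) ≥ 2`,
  `|𝒟_k(b,b″) − 𝒟^Π_{k,loc}(b,b″)| ≤ 3M²M_C·d²e^{a/2}K(a)²·(d−1)!/a^{d−1}·e^{−cρ_k}·e^{−(a/2)dist_k(b,b″)}`, `a = min(δ/2, δ_C)/2`, `c = min(δ/32, δ_C/4)`,
  GIVEN the sup member of (I.7.2.2) for every `H_j` (`j < k`; constants `M, δ`), bounds `M_Ce^{−δ_C|·|}` for p09's `Cmat`/`Cloc` of record and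
  `M_Ce^{−(δ_C/4)ρ_j}e^{−δ_C|·|}` for their difference at the radii `ρ_j/4`, and a schedule with `0 < ρ_j`, `ρ_k ≤ ρ_j` (`j < k`) — the statement of
  r18 g10's `abs_dk_sub_dkLoc_le` for the fork, same constants.
* §3 **HYPOTHESIS-FREE OVER ALL TORI, ONE SET OF CONSTANTS** (only `2 ≤ d`): **`close_dkLocPi_dk_allTori`** — `∃ R₀ c₀ c δ′`, `0 < c`, `0 < δ′`,
  `0 ≤ c₀`, for EVERY torus `P` (`P.d = d`, `P.L = L`), every `k ≤ m + K`, every schedule with `0 < ρ_j`, `ρ_k ≤ ρ_j` (`j < k`) and all `b, b″` with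
  `dist_k(b,b″) ≥ R₀`: `|𝒟_k(b,b″) − 𝒟^Π_{k,loc}(b,b″)| ≤ c₀e^{−cρ_k}e^{−δ′dist_k(b,b″)}` (H-side: gen 21's `exists_holderBounds_allTori` = (I.7.2.2) with
  *"constants independent of k, T_η"* from [6I] Prop. 1.2 over all tori; C-side: p09's `(d, L)`-only `cloc_estimates` through r18 g10's
  `cSide_of_cloc_estimates`); the per-torus corollary `close_dkLocPi_dk_torus`; and AT THE PRINTED SCHEDULE `ρ_j = r(e_j)` (`rSched`, (2.2)–(2.3),
  `d ≤ 4`, `log e_k⁻¹ > 0`): `close_dkLocPi_dk_allTori_rSched`, `close_dkLocPi_dk_torus_rSched` — smallness literally `e^{−c·r(e_k)}`.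
HONEST SCOPE.  (i) Kernel form BEYOND A THRESHOLD (`dist_k ≥ R₀ = 2`), exactly as r18 g10's file for the object of record (near the diagonal the
scale sum carries `Σ_{j<k}(L^{k−j})^{d−2}`); the printed use (the `w′₁`-display after (5.4.3), p. 282) is an operator statement with the `η^d`
pairing weight and the `∂*ε*δΠ` dressing on r16's row C2.Eq5.4.7 — NOT proved here; p08's operator-form `BIJ88OpCloseDkLoc{,Grad}Torus` concern
the object of record and are untouched.  (ii) The object of record `BIJ88CurlyDkLocTorus.dkLocKer` is NOT modified; `dkLocKerPi` is its twin with
the smooth cutoff print asks for (same `H_j`, same `C^{(j)}_{loc}`, same 0/1 regions (2.1)); heads of rows C2.Eq2.12/2.13 unchanged.  (iii) The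
smallness is `e^{−cρ_k}` for any positive schedule non-increasing in `j < k`; for the printed `r(e_j)` (`d ≤ 4`) this is `e^{−cr(e_k)}`, the
monotonicity supplied by r18 g11's `rSched_pos_of_le`/`rSched_anti` under `log e_k⁻¹ > 0`.  (iv) No radius admissibility is needed here (closeness
uses only `ζ^Π_j = 1` within `ρ_j/16` and `0 ≤ ζ^Π_j ≤ 1`), unlike the Hölder member of the companion file.  (v) `U = 1`, real abelian fields, tori
of the series, standing range `k ≤ m + K`, every `d ≥ 2`; constants explicit in §2, existential from `(d, L)` in §3.  NOT summit progress; NOT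
continuum; NOT Clay.  Unit `lit-balaban-r18` (literature-prover-lit-balaban-r18-g30-0), 2026-08-23.
-/

open scoped BigOperators RealInnerProductSpace

namespace Literature.MathematicalPhysics.QuantumFieldTheory.BalabanImbrieJaffe1984to88.BIJ88CurlyDkLocPiCloseTorus

open Balaban1983to89 hiding Site Plaq
open Balaban1983to89.LatticeFieldCalculus
open BIJ88Ineq217Ineq722Torus (ofLp_HkE_single)
open BIJ85AxialPropagator411 (toE)
open BIJ85Prop521Torus BIJ85Prop522Torus BIJ85Sigma422Eta
open BIJ85Sect7Statements BIJ85Ineq722Torus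
open BIJ85Ineq722DeltaA (deltaAData)
open BIJ88ClocFactorsTorus (Cmat distB distB_apply)
open BIJ88ClocEstimatesTorus (Cloc cloc_estimates)
open BIJ85CurlyDkDecayTorus (dkKernel_eq_sum)
open BIJ88CurlyDkLocDecayTorus (abs_sum_scales_le)
open BIJ88CurlyDkLocTorus (hKer hdist cKer clKer dkLocKer kdist rSched cKer_ambient_eq clKer_ambient_eq_apply)
open BIJ88CurlyDkLocGradTerm (abs_triple_le₂)
open BIJ88HkLocHolderTorus (zetaPi hlKerPi hlKerPi_apply zetaPi_nonneg zetaPi_le_one zetaPi_eq_one_of_le exists_holderBounds_allTori)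
open BIJ88CurlyDkLocHolderTorus (termKerPi dkLocKerPi dkLocKerPi_eq_sum termKerPi_eq_sum abs_hlKerPi_le_abs)
open BIJ88CurlyDkLocCloseTorus (abs_cKer_sub_clKer_ambient_le cSide_of_cloc_estimates rSched_pos_of_le rSched_anti)
open BIJ88Sect2Statements (eK)

open Balaban1983to89 renaming Site → TSite, Plaq → TPlaq

noncomputable section

variable {P : Params}

/-! ## §1  (2.7) for `H^Π_{j,loc} = ζ^Π_jH_j` -/

/-- `0 < L^n`. [folklore] -/
private theorem cast_pow_L_pos' (n : ℕ) : (0 : ℝ) < (P.L : ℝ) ^ n := pow_pos P.cast_L_pos n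

/-- **(2.7) FOR THE SMOOTH-CUTOFF OBJECT `H^Π_{j,loc} = ζ^Π_jH_j`**: with gen 21's product-form cutoff `ζ^Π_j` of radii `R₁ < R₀` and the sup member
of (I.7.2.2) for `H_j` (`|H_j(b,b₁)| ≤ Me^{−δ dist(b,b₁)}`), the difference `H_j − H^Π_{j,loc} = (1 − ζ^Π_j)H_j` VANISHES for `dist(b,b₁) ≤ R₁`
(`ζ^Π_j = 1` there, (2.1)) and satisfies `|H_j(b,b₁) − H^Π_{j,loc}(b,b₁)| ≤ Me^{−(δ/2)R₁}·e^{−(δ/2)dist(b,b₁)}` everywhere (`0 ≤ ζ^Π_j ≤ 1`) — the printed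
*"|H_{k,loc} − H_k| ≦ e^{−cr(e_k)}e^{−c dist}"* with `R₁ = r(e_k)/16`. [cite: BalabanImbrieJaffe1988, (2.7) p.260] -/
theorem abs_hKer_sub_hlKerPi_le {j : ℕ} (hj : j ≤ P.m + P.K) {w c : ℝ} (hw : 0 < w) (hc : c ≠ 0) {a : ℝ} (ha : 0 < a) {δ M : ℝ}
    (hδ : 0 ≤ δ)
    (hH : ∀ (μ ν : Fin P.d) (x : TSite P 0) (y : TSite P j),
      |(torusRep P j (deltaAData hj a)).H (x, μ) (y, ν)| ≤ M * Real.exp (-(δ * distEU P j x y)))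
    {R₁ R₀ : ℝ} (hR : R₁ < R₀) (b₀ : PBond P 0) (b₁ : PBond P j) :
    |hKer (P := P) w c j b₀ b₁ - hlKerPi (P := P) w c R₁ R₀ j b₀ b₁| ≤
      M * Real.exp (-(δ / 2 * R₁)) * Real.exp (-(δ / 2 * distEU P j b₀.src b₁.src)) := by
  have hM : 0 ≤ M := by
    have h := hH b₀.dir b₁.dir b₀.src b₁.src
    exact (mul_nonneg_iff_of_pos_right (Real.exp_pos _)).1 ((abs_nonneg _).trans h)
  by_cases hnear : distEU P j b₀.src b₁.src ≤ R₁
  · -- within `R₁` the smooth cutoff is `1`: the difference vanishes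
    have hζ : zetaPi (P := P) R₁ R₀ j b₀.src b₁.src = 1 := zetaPi_eq_one_of_le hR hnear
    rw [hlKerPi_apply, hζ, one_mul, sub_self, abs_zero]
    positivity
  · -- beyond `R₁`: `|(1 − ζ^Π)H| ≤ |H| ≤ Me^{−δ dist} ≤ Me^{−(δ/2)R₁}e^{−(δ/2)dist}`
    have hfar : R₁ ≤ distEU P j b₀.src b₁.src := (not_le.1 hnear).le
    have e : hKer (P := P) w c j b₀ b₁ = (torusRep P j (deltaAData hj a)).H (b₀.src, b₀.dir) (b₁.src, b₁.dir) :=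
      ofLp_HkE_single hj hc hw ha b₁ b₀.src b₀.dir
    have hdiff : |hKer (P := P) w c j b₀ b₁ - hlKerPi (P := P) w c R₁ R₀ j b₀ b₁| ≤ |hKer (P := P) w c j b₀ b₁| := by
      rw [hlKerPi_apply]
      have h0 := zetaPi_nonneg (P := P) R₁ R₀ j b₀.src b₁.src
      have h1 := zetaPi_le_one (P := P) R₁ R₀ j b₀.src b₁.src
      have hfac : hKer (P := P) w c j b₀ b₁ - zetaPi (P := P) R₁ R₀ j b₀.src b₁.src * hKer (P := P) w c j b₀ b₁ =
          (1 - zetaPi (P := P) R₁ R₀ j b₀.src b₁.src) * hKer (P := P) w c j b₀ b₁ := by ring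
      rw [hfac, abs_mul, abs_of_nonneg (by linarith)]
      exact mul_le_of_le_one_left (abs_nonneg _) (by linarith)
    refine hdiff.trans ?_
    rw [e]
    refine (hH _ _ _ _).trans ?_
    rw [mul_assoc, ← Real.exp_add]
    refine mul_le_mul_of_nonneg_left (Real.exp_le_exp.2 ?_) hM
    nlinarith [mul_nonneg hδ (sub_nonneg.2 hfar)]

/-! ## §2  The difference `𝒟_k − 𝒟^Π_{k,loc}` as a telescoped scale sum, and its bound -/

/-- `𝒟_k(b,b″) − 𝒟^Π_{k,loc}(b,b″) = Σ_{j<k}Σ_{b₁,b₂}[H C H − H^Π_lC_lH^Π_l]` for the (I.4.4.4) propagator of record (p08's `dkKernel_eq_sum`) and r18 g30's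
fork of (2.12), both at the weights `(w, c)`. [cite: BalabanImbrieJaffe1988, (2.12) p.261] -/
theorem dk_sub_dkLocPi_eq_sum (w c : ℝ) (ρ : ℕ → ℝ) (k : ℕ) (b b'' : PBond P 0) :
    DkE P w c k (toE P (Pi.single b'' 1)) b - dkLocKerPi (P := P) w c ρ k b b'' =
      ∑ j ∈ Finset.range k, ∑ b₁ : PBond P j, ∑ b₂ : PBond P j,
        (hKer (P := P) w c j b b₁ * cKer (P := P) w c j b₁ b₂ * hKer (P := P) w c j b'' b₂ -
          hlKerPi (P := P) w c (ρ j / 16) (ρ j / 8) j b b₁ * clKer (P := P) w c (ρ j / 4) j b₁ b₂ *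
            hlKerPi (P := P) w c (ρ j / 16) (ρ j / 8) j b'' b₂) := by
  have h1 : DkE P w c k (toE P (Pi.single b'' 1)) b = ∑ j ∈ Finset.range k, ∑ b₁ : PBond P j, ∑ b₂ : PBond P j,
      hKer (P := P) w c j b b₁ * cKer (P := P) w c j b₁ b₂ * hKer (P := P) w c j b'' b₂ :=
    dkKernel_eq_sum w c k b b''
  rw [h1, dkLocKerPi_eq_sum]
  simp only [termKerPi_eq_sum, ← Finset.sum_sub_distrib]

/-- the telescoping `hch′ − h_lc_lh′_l = (h − h_l)ch′ + h_l(c − c_l)h′ + h_lc_l(h′ − h′_l)`. [folklore] -/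
private theorem telescope (h hl c cl h' hl' : ℝ) :
    h * c * h' - hl * cl * hl' = (h - hl) * c * h' + hl * (c - cl) * h' + hl * cl * (h' - hl') := by ring

/-- `L^k = L^j·L^{k−j}` for `j ≤ k`. [folklore] -/
private theorem pow_eq_pow_mul_pow' {j k : ℕ} (hjk : j ≤ k) : (P.L : ℝ) ^ k = (P.L : ℝ) ^ j * (P.L : ℝ) ^ (k - j) := by
  rw [← pow_add, Nat.add_sub_cancel' hjk]

/-- **THE SCALE-`j` DIFFERENCE TERM FOR THE FORK** (`j ≤ k`, `j ≤ m + K`, every `d ≥ 2`): at the weights `(η_k^d, L^k)` and the radii `r/16 < r/8`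
(for `ζ^Π_j`), `r/4` (for `C̃^{(j)}`), `r > 0`,
`|Σ_{b₁,b₂}[H_jC^{(j),L^jη}H_j − H^Π_{j,loc}C^{(j),L^jη}_{loc}H^Π_{j,loc}](b,b″)| ≤ M²M_C(L^{k−j})^{d−2}·d²e^{a/2}K(a)²·(2e^{−(δ/32)r} + e^{−(δ_C/4)r})·e^{−a|b₋−b″₋|_∞/L^j}`,
`a = min(δ/2, δ_C)/2` — the three telescoped products, each by p08's `abs_triple_le₂`; the statement of r18 g10's `abs_diffTerm_le` for the smooth
cutoff. [cite: BalabanImbrieJaffe1988, (2.13) p.261] -/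
theorem abs_diffTermPi_le (hd : 2 ≤ P.d) {k j : ℕ} (hj : j ≤ P.m + P.K) (hjk : j ≤ k) {a : ℝ} (ha : 0 < a)
    {δ M δC MC : ℝ} (hδ : 0 < δ) (hδC : 0 < δC) (hM : 0 ≤ M) (hMC : 0 ≤ MC)
    (hH : ∀ (μ ν : Fin P.d) (x : TSite P 0) (y : TSite P j),
      |(torusRep P j (deltaAData hj a)).H (x, μ) (y, ν)| ≤ M * Real.exp (-(δ * distEU P j x y)))
    {r : ℝ} (hr : 0 < r)
    (hCm : ∀ b₁ b₂ : PBond P j, |Cmat P j b₁ b₂| ≤ MC * Real.exp (-(δC * (supDist b₁.src b₂.src : ℝ))))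
    (hCl : ∀ b₁ b₂ : PBond P j, |Cloc P j (r / 4) b₁ b₂| ≤ MC * Real.exp (-(δC * (supDist b₁.src b₂.src : ℝ))))
    (hCd : ∀ b₁ b₂ : PBond P j, |Cloc P j (r / 4) b₁ b₂ - Cmat P j b₁ b₂| ≤
      MC * Real.exp (-(δC / 4 * r)) * Real.exp (-(δC * (supDist b₁.src b₂.src : ℝ))))
    (b b'' : PBond P 0) :
    |∑ b₁ : PBond P j, ∑ b₂ : PBond P j,
        (hKer (P := P) ((P.eta k) ^ P.d) ((P.L : ℝ) ^ k) j b b₁ * cKer (P := P) ((P.eta k) ^ P.d) ((P.L : ℝ) ^ k) j b₁ b₂ *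
            hKer (P := P) ((P.eta k) ^ P.d) ((P.L : ℝ) ^ k) j b'' b₂ -
          hlKerPi (P := P) ((P.eta k) ^ P.d) ((P.L : ℝ) ^ k) (r / 16) (r / 8) j b b₁ *
              clKer (P := P) ((P.eta k) ^ P.d) ((P.L : ℝ) ^ k) (r / 4) j b₁ b₂ *
            hlKerPi (P := P) ((P.eta k) ^ P.d) ((P.L : ℝ) ^ k) (r / 16) (r / 8) j b'' b₂)| ≤
      M ^ 2 * MC * ((P.L : ℝ) ^ (k - j)) ^ (P.d - 2) *
          ((P.d : ℝ) ^ 2 * (Real.exp (min (δ / 2) δC / 2 / 2) * ((2 * (1 + P.d / (min (δ / 2) δC / 2))) ^ P.d) ^ 2)) *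
          (2 * Real.exp (-(δ / 2 * (r / 16))) + Real.exp (-(δC / 4 * r))) *
        Real.exp (-(min (δ / 2) δC / 2 * ((supDist b.src b''.src : ℝ) / (P.L : ℝ) ^ j))) := by
  have hδ2 : 0 < δ / 2 := half_pos hδ
  have hR : r / 16 < r / 8 := by linarith
  have hw : 0 < (P.eta k) ^ P.d := pow_pos (eta_pos P k) _
  have hc : (P.L : ℝ) ^ k ≠ 0 := (cast_pow_L_pos' k).ne'
  set ℓ : ℝ := (P.L : ℝ) ^ (k - j) with hℓ
  have hℓq : 0 < ℓ ^ (P.d - 2) := pow_pos (cast_pow_L_pos' _) _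
  -- the H-side bounds at rate `δ/2`
  have weaken : ∀ (x : TSite P 0) (y : TSite P j),
      M * Real.exp (-(δ * distEU P j x y)) ≤ M * Real.exp (-(δ / 2 * distEU P j x y)) := by
    intro x y
    refine mul_le_mul_of_nonneg_left (Real.exp_le_exp.2 ?_) hM
    have h0 : 0 ≤ distEU P j x y := div_nonneg (Nat.cast_nonneg _) (cast_pow_L_pos' j).le
    nlinarith
  have hh : ∀ (b₀ : PBond P 0) (b₁ : PBond P j),
      |hKer (P := P) ((P.eta k) ^ P.d) ((P.L : ℝ) ^ k) j b₀ b₁| ≤ M * Real.exp (-(δ / 2 * distEU P j b₀.src b₁.src)) := by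
    intro b₀ b₁
    have e : hKer (P := P) ((P.eta k) ^ P.d) ((P.L : ℝ) ^ k) j b₀ b₁ =
        (torusRep P j (deltaAData hj a)).H (b₀.src, b₀.dir) (b₁.src, b₁.dir) := ofLp_HkE_single hj hc hw ha b₁ b₀.src b₀.dir
    rw [e]
    exact (hH _ _ _ _).trans (weaken _ _)
  have hhl : ∀ (b₀ : PBond P 0) (b₁ : PBond P j),
      |hlKerPi (P := P) ((P.eta k) ^ P.d) ((P.L : ℝ) ^ k) (r / 16) (r / 8) j b₀ b₁| ≤
        M * Real.exp (-(δ / 2 * distEU P j b₀.src b₁.src)) :=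
    fun b₀ b₁ => (abs_hlKerPi_le_abs _ _ _ _ j b₀ b₁).trans (hh b₀ b₁)
  have hhd : ∀ (b₀ : PBond P 0) (b₁ : PBond P j),
      |hKer (P := P) ((P.eta k) ^ P.d) ((P.L : ℝ) ^ k) j b₀ b₁ -
          hlKerPi (P := P) ((P.eta k) ^ P.d) ((P.L : ℝ) ^ k) (r / 16) (r / 8) j b₀ b₁| ≤
        M * Real.exp (-(δ / 2 * (r / 16))) * Real.exp (-(δ / 2 * distEU P j b₀.src b₁.src)) :=
    fun b₀ b₁ => abs_hKer_sub_hlKerPi_le hj hw hc ha hδ.le hH hR b₀ b₁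
  -- the C-side bounds at the ambient weights
  have hc1 : ∀ b₁ b₂ : PBond P j, |cKer (P := P) ((P.eta k) ^ P.d) ((P.L : ℝ) ^ k) j b₁ b₂| ≤
      MC * ℓ ^ (P.d - 2) * Real.exp (-(δC * (supDist b₁.src b₂.src : ℝ))) := by
    intro b₁ b₂
    rw [cKer_ambient_eq hd hjk, abs_mul, abs_of_pos hℓq]
    calc ℓ ^ (P.d - 2) * |Cmat P j b₁ b₂| ≤ ℓ ^ (P.d - 2) * (MC * Real.exp (-(δC * (supDist b₁.src b₂.src : ℝ)))) :=
        mul_le_mul_of_nonneg_left (hCm b₁ b₂) hℓq.le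
      _ = _ := by ring
  have hc2 : ∀ b₁ b₂ : PBond P j, |clKer (P := P) ((P.eta k) ^ P.d) ((P.L : ℝ) ^ k) (r / 4) j b₁ b₂| ≤
      MC * ℓ ^ (P.d - 2) * Real.exp (-(δC * (supDist b₁.src b₂.src : ℝ))) := by
    intro b₁ b₂
    rw [clKer_ambient_eq_apply hd hjk, abs_mul, abs_of_pos hℓq]
    calc ℓ ^ (P.d - 2) * |Cloc P j (r / 4) b₁ b₂| ≤ ℓ ^ (P.d - 2) * (MC * Real.exp (-(δC * (supDist b₁.src b₂.src : ℝ)))) :=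
        mul_le_mul_of_nonneg_left (hCl b₁ b₂) hℓq.le
      _ = _ := by ring
  have hc3 : ∀ b₁ b₂ : PBond P j, |cKer (P := P) ((P.eta k) ^ P.d) ((P.L : ℝ) ^ k) j b₁ b₂ -
      clKer (P := P) ((P.eta k) ^ P.d) ((P.L : ℝ) ^ k) (r / 4) j b₁ b₂| ≤
      (ℓ ^ (P.d - 2) * MC * Real.exp (-(δC / 4 * r))) * Real.exp (-(δC * (supDist b₁.src b₂.src : ℝ))) := by
    intro b₁ b₂
    have h := abs_cKer_sub_clKer_ambient_le hd hjk (δC := δC) (ε := MC * Real.exp (-(δC / 4 * r))) (R := r / 4)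
      (fun b₁ b₂ => (hCd b₁ b₂).trans (le_of_eq (by ring))) b₁ b₂
    refine h.trans (le_of_eq ?_)
    rw [hℓ]; ring
  -- the three telescoped products
  have hM' : 0 ≤ M * Real.exp (-(δ / 2 * (r / 16))) := by positivity
  have hMC1 : 0 ≤ MC * ℓ ^ (P.d - 2) := by positivity
  have hMC3 : 0 ≤ ℓ ^ (P.d - 2) * MC * Real.exp (-(δC / 4 * r)) := by positivity
  have t1 := abs_triple_le₂ hj hδ2 hδC hM' hM hMC1 hhd hh hc1 b b''
  have t2 := abs_triple_le₂ hj hδ2 hδC hM hM hMC3 hhl hh hc3 b b''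
  have t3 := abs_triple_le₂ hj hδ2 hδC hM hM' hMC1 hhl hhd hc2 b b''
  -- split the scale term into the three products
  have hsplit : (∑ b₁ : PBond P j, ∑ b₂ : PBond P j,
        (hKer (P := P) ((P.eta k) ^ P.d) ((P.L : ℝ) ^ k) j b b₁ * cKer (P := P) ((P.eta k) ^ P.d) ((P.L : ℝ) ^ k) j b₁ b₂ *
            hKer (P := P) ((P.eta k) ^ P.d) ((P.L : ℝ) ^ k) j b'' b₂ -
          hlKerPi (P := P) ((P.eta k) ^ P.d) ((P.L : ℝ) ^ k) (r / 16) (r / 8) j b b₁ *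
              clKer (P := P) ((P.eta k) ^ P.d) ((P.L : ℝ) ^ k) (r / 4) j b₁ b₂ *
            hlKerPi (P := P) ((P.eta k) ^ P.d) ((P.L : ℝ) ^ k) (r / 16) (r / 8) j b'' b₂)) =
      (∑ b₁ : PBond P j, ∑ b₂ : PBond P j,
        (hKer (P := P) ((P.eta k) ^ P.d) ((P.L : ℝ) ^ k) j b b₁ -
            hlKerPi (P := P) ((P.eta k) ^ P.d) ((P.L : ℝ) ^ k) (r / 16) (r / 8) j b b₁) *
          cKer (P := P) ((P.eta k) ^ P.d) ((P.L : ℝ) ^ k) j b₁ b₂ * hKer (P := P) ((P.eta k) ^ P.d) ((P.L : ℝ) ^ k) j b'' b₂) +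
      (∑ b₁ : PBond P j, ∑ b₂ : PBond P j,
        hlKerPi (P := P) ((P.eta k) ^ P.d) ((P.L : ℝ) ^ k) (r / 16) (r / 8) j b b₁ *
          (cKer (P := P) ((P.eta k) ^ P.d) ((P.L : ℝ) ^ k) j b₁ b₂ -
            clKer (P := P) ((P.eta k) ^ P.d) ((P.L : ℝ) ^ k) (r / 4) j b₁ b₂) *
          hKer (P := P) ((P.eta k) ^ P.d) ((P.L : ℝ) ^ k) j b'' b₂) +
      (∑ b₁ : PBond P j, ∑ b₂ : PBond P j,
        hlKerPi (P := P) ((P.eta k) ^ P.d) ((P.L : ℝ) ^ k) (r / 16) (r / 8) j b b₁ *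
          clKer (P := P) ((P.eta k) ^ P.d) ((P.L : ℝ) ^ k) (r / 4) j b₁ b₂ *
          (hKer (P := P) ((P.eta k) ^ P.d) ((P.L : ℝ) ^ k) j b'' b₂ -
            hlKerPi (P := P) ((P.eta k) ^ P.d) ((P.L : ℝ) ^ k) (r / 16) (r / 8) j b'' b₂)) := by
    rw [← Finset.sum_add_distrib, ← Finset.sum_add_distrib]
    refine Finset.sum_congr rfl fun b₁ _ => ?_
    rw [← Finset.sum_add_distrib, ← Finset.sum_add_distrib]
    refine Finset.sum_congr rfl fun b₂ _ => ?_
    exact telescope _ _ _ _ _ _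
  rw [hsplit]
  refine (abs_add_three _ _ _).trans ?_
  refine (add_le_add (add_le_add t1 t2) t3).trans (le_of_eq ?_)
  rw [hℓ]
  ring

/-- **THE KERNEL CLOSENESS `|𝒟_k(b,b″) − 𝒟^Π_{k,loc}(b,b″)| ≤ c₀e^{−cρ_k}e^{−(a/2)dist_k(b,b″)}` FOR `dist_k ≥ 2`, explicit constants, every `d ≥ 2`**
(`a = min(δ/2, δ_C)/2`, `c = min(δ/32, δ_C/4)`): GIVEN the sup member of (I.7.2.2) for every `H_j`, `j < k` (`M, δ`), bounds `M_Ce^{−δ_C|·|}` for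
p09's `C^{(j)}` and `C^{(j)}_{loc}` of record and `M_Ce^{−(δ_C/4)ρ_j}e^{−δ_C|·|}` for their difference at the radii `ρ_j/4`, and a schedule with
`0 < ρ_j`, `ρ_k ≤ ρ_j` for `j < k`: the scale terms of `abs_diffTermPi_le` carry `2e^{−(δ/32)ρ_j} + e^{−(δ_C/4)ρ_j} ≤ 3e^{−cρ_k}`, and p08's
multiscale step sums `(L^{k−j})^{d−2}e^{−aL^{k−j}D}` — r18 g10's `abs_dk_sub_dkLoc_le` for the fork, same constants.
[cite: BalabanImbrieJaffe1988, (2.13) p.261] -/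
theorem abs_dk_sub_dkLocPi_le (hd : 2 ≤ P.d) {k : ℕ} (hk : k ≤ P.m + P.K) {a : ℝ} (ha : 0 < a) {δ M δC MC : ℝ} (hδ : 0 < δ)
    (hδC : 0 < δC) (hM : 0 ≤ M) (hMC : 0 ≤ MC)
    (hH : ∀ (j : ℕ) (hj : j ≤ P.m + P.K), j < k → ∀ (μ ν : Fin P.d) (x : TSite P 0) (y : TSite P j),
      |(torusRep P j (deltaAData hj a)).H (x, μ) (y, ν)| ≤ M * Real.exp (-(δ * distEU P j x y)))
    (ρ : ℕ → ℝ) (hρ : ∀ j < k, 0 < ρ j) (hmono : ∀ j < k, ρ k ≤ ρ j)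
    (hCm : ∀ j < k, ∀ b₁ b₂ : PBond P j, |Cmat P j b₁ b₂| ≤ MC * Real.exp (-(δC * (supDist b₁.src b₂.src : ℝ))))
    (hCl : ∀ j < k, ∀ b₁ b₂ : PBond P j, |Cloc P j (ρ j / 4) b₁ b₂| ≤ MC * Real.exp (-(δC * (supDist b₁.src b₂.src : ℝ))))
    (hCd : ∀ j < k, ∀ b₁ b₂ : PBond P j, |Cloc P j (ρ j / 4) b₁ b₂ - Cmat P j b₁ b₂| ≤
      MC * Real.exp (-(δC / 4 * ρ j)) * Real.exp (-(δC * (supDist b₁.src b₂.src : ℝ))))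
    {b b'' : PBond P 0} (hD : 2 ≤ kdist (P := P) k b b'') :
    |DkE P ((P.eta k) ^ P.d) ((P.L : ℝ) ^ k) k (toE P (Pi.single b'' 1)) b -
        dkLocKerPi (P := P) ((P.eta k) ^ P.d) ((P.L : ℝ) ^ k) ρ k b b''| ≤
      3 * M ^ 2 * MC * ((P.d : ℝ) ^ 2 * (Real.exp (min (δ / 2) δC / 2 / 2) * ((2 * (1 + P.d / (min (δ / 2) δC / 2))) ^ P.d) ^ 2)) *
          Real.exp (-(min (δ / 32) (δC / 4) * ρ k)) *
          ((((P.d - 2 + 1).factorial : ℝ)) / (min (δ / 2) δC / 2) ^ (P.d - 2 + 1)) *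
        Real.exp (-(min (δ / 2) δC / 2 / 2 * kdist (P := P) k b b'')) := by
  have hδ2 : 0 < δ / 2 := half_pos hδ
  have ha₀ : 0 < min (δ / 2) δC / 2 := half_pos (lt_min hδ2 hδC)
  have hcc0 : 0 ≤ min (δ / 32) (δC / 4) := le_min (by positivity) (by positivity)
  have hcc1 : min (δ / 32) (δC / 4) ≤ δ / 32 := min_le_left _ _
  have hcc2 : min (δ / 32) (δC / 4) ≤ δC / 4 := min_le_right _ _
  rw [dk_sub_dkLocPi_eq_sum]
  refine abs_sum_scales_le (P := P) (k := k)
    (T := fun j => ∑ b₁ : PBond P j, ∑ b₂ : PBond P j,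
        (hKer (P := P) ((P.eta k) ^ P.d) ((P.L : ℝ) ^ k) j b b₁ * cKer (P := P) ((P.eta k) ^ P.d) ((P.L : ℝ) ^ k) j b₁ b₂ *
            hKer (P := P) ((P.eta k) ^ P.d) ((P.L : ℝ) ^ k) j b'' b₂ -
          hlKerPi (P := P) ((P.eta k) ^ P.d) ((P.L : ℝ) ^ k) (ρ j / 16) (ρ j / 8) j b b₁ *
              clKer (P := P) ((P.eta k) ^ P.d) ((P.L : ℝ) ^ k) (ρ j / 4) j b₁ b₂ *
            hlKerPi (P := P) ((P.eta k) ^ P.d) ((P.L : ℝ) ^ k) (ρ j / 16) (ρ j / 8) j b'' b₂))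
    (A := 3 * M ^ 2 * MC * ((P.d : ℝ) ^ 2 * (Real.exp (min (δ / 2) δC / 2 / 2) *
        ((2 * (1 + P.d / (min (δ / 2) δC / 2))) ^ P.d) ^ 2)) * Real.exp (-(min (δ / 32) (δC / 4) * ρ k)))
    (a := min (δ / 2) δC / 2) (D := kdist (P := P) k b b'') (by positivity) ha₀ hD (P.d - 2) fun j hjk => ?_
  have hj : j ≤ P.m + P.K := by omega
  have hρj : 0 < ρ j := hρ j hjk
  have hρkj : ρ k ≤ ρ j := hmono j hjk
  have hterm := abs_diffTermPi_le hd hj hjk.le ha hδ hδC hM hMC (hH j hj hjk) hρj (hCm j hjk) (hCl j hjk) (hCd j hjk) b b''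
  -- `supDist/L^j = L^{k−j}·dist_k`
  have e1 : (supDist b.src b''.src : ℝ) / (P.L : ℝ) ^ j = (P.L : ℝ) ^ (k - j) * kdist (P := P) k b b'' := by
    unfold kdist
    rw [pow_eq_pow_mul_pow' (P := P) hjk.le]
    have hLj := cast_pow_L_pos' (P := P) j
    have hLkj := cast_pow_L_pos' (P := P) (k - j)
    field_simp
  rw [e1] at hterm
  -- the smallness factors are at most `e^{−cρ_k}`
  have hs1 : Real.exp (-(δ / 2 * (ρ j / 16))) ≤ Real.exp (-(min (δ / 32) (δC / 4) * ρ k)) := by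
    refine Real.exp_le_exp.2 ?_
    nlinarith [mul_le_mul_of_nonneg_right hcc1 hρj.le, mul_le_mul_of_nonneg_left hρkj hcc0]
  have hs2 : Real.exp (-(δC / 4 * ρ j)) ≤ Real.exp (-(min (δ / 32) (δC / 4) * ρ k)) := by
    refine Real.exp_le_exp.2 ?_
    nlinarith [mul_le_mul_of_nonneg_right hcc2 hρj.le, mul_le_mul_of_nonneg_left hρkj hcc0]
  have hs : 2 * Real.exp (-(δ / 2 * (ρ j / 16))) + Real.exp (-(δC / 4 * ρ j)) ≤
      3 * Real.exp (-(min (δ / 32) (δC / 4) * ρ k)) := by linarith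
  refine hterm.trans ?_
  have hW : 0 ≤ M ^ 2 * MC * ((P.L : ℝ) ^ (k - j)) ^ (P.d - 2) *
      ((P.d : ℝ) ^ 2 * (Real.exp (min (δ / 2) δC / 2 / 2) * ((2 * (1 + P.d / (min (δ / 2) δC / 2))) ^ P.d) ^ 2)) *
      Real.exp (-(min (δ / 2) δC / 2 * ((P.L : ℝ) ^ (k - j) * kdist (P := P) k b b''))) := by positivity
  calc M ^ 2 * MC * ((P.L : ℝ) ^ (k - j)) ^ (P.d - 2) *
          ((P.d : ℝ) ^ 2 * (Real.exp (min (δ / 2) δC / 2 / 2) * ((2 * (1 + P.d / (min (δ / 2) δC / 2))) ^ P.d) ^ 2)) *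
          (2 * Real.exp (-(δ / 2 * (ρ j / 16))) + Real.exp (-(δC / 4 * ρ j))) *
        Real.exp (-(min (δ / 2) δC / 2 * ((P.L : ℝ) ^ (k - j) * kdist (P := P) k b b'')))
      = (M ^ 2 * MC * ((P.L : ℝ) ^ (k - j)) ^ (P.d - 2) *
          ((P.d : ℝ) ^ 2 * (Real.exp (min (δ / 2) δC / 2 / 2) * ((2 * (1 + P.d / (min (δ / 2) δC / 2))) ^ P.d) ^ 2)) *
          Real.exp (-(min (δ / 2) δC / 2 * ((P.L : ℝ) ^ (k - j) * kdist (P := P) k b b'')))) *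
          (2 * Real.exp (-(δ / 2 * (ρ j / 16))) + Real.exp (-(δC / 4 * ρ j))) := by ring
    _ ≤ (M ^ 2 * MC * ((P.L : ℝ) ^ (k - j)) ^ (P.d - 2) *
          ((P.d : ℝ) ^ 2 * (Real.exp (min (δ / 2) δC / 2 / 2) * ((2 * (1 + P.d / (min (δ / 2) δC / 2))) ^ P.d) ^ 2)) *
          Real.exp (-(min (δ / 2) δC / 2 * ((P.L : ℝ) ^ (k - j) * kdist (P := P) k b b'')))) *
          (3 * Real.exp (-(min (δ / 32) (δC / 4) * ρ k))) := mul_le_mul_of_nonneg_left hs hW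
    _ = _ := by ring

/-! ## §3  Over all tori, no hypothesis, one set of constants; the printed schedule -/

/-- **`𝒟^Π_{k,loc}` IS CLOSE TO `𝒟_k` OVER ALL TORI — HYPOTHESIS-FREE, ONE SET OF CONSTANTS** (only `2 ≤ d`): there is ONE `(R₀, c₀, c, δ′)` with
`0 < c`, `0 < δ′`, `0 ≤ c₀` such that for EVERY torus `P` of the series with `P.d = d`, `P.L = L`, every `k ≤ m + K`, every radius schedule with
`0 < ρ_j`, `ρ_k ≤ ρ_j` (`j < k`) and all `η`-bonds with `dist_k(b,b″) ≥ R₀`: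
`|𝒟_k(b,b″) − 𝒟^Π_{k,loc}(b,b″)| ≤ c₀·e^{−cρ_k}·e^{−δ′dist_k(b,b″)}` — the p. 261 clause *"𝒟_{k,loc} is close to 𝒟_k"* in kernel form for the
smooth-cutoff (2.12), with the (2.7)-type smallness; H-side from gen 21's `exists_holderBounds_allTori` ((I.7.2.2), *"constants independent of k, T_η"*,
[6I] Prop. 1.2 over all tori inside), C-side from p09's `(d, L)`-only `cloc_estimates`. [cite: BalabanImbrieJaffe1988, (2.13) p.261] -/
theorem close_dkLocPi_dk_allTori {d L : ℕ} (hd : 2 ≤ d) :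
    ∃ R₀ c₀ c δ' : ℝ, 0 < c ∧ 0 < δ' ∧ 0 ≤ c₀ ∧ ∀ (P : Params) (_ : P.d = d) (_ : P.L = L) (k : ℕ) (_ : k ≤ P.m + P.K)
      (ρ : ℕ → ℝ), (∀ j < k, 0 < ρ j) → (∀ j < k, ρ k ≤ ρ j) → ∀ (b b'' : PBond P 0), R₀ ≤ kdist (P := P) k b b'' →
        |DkE P ((P.eta k) ^ P.d) ((P.L : ℝ) ^ k) k (toE P (Pi.single b'' 1)) b -
            dkLocKerPi (P := P) ((P.eta k) ^ P.d) ((P.L : ℝ) ^ k) ρ k b b''| ≤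
          c₀ * Real.exp (-(c * ρ k)) * Real.exp (-δ' * kdist (P := P) k b b'') := by
  classical
  obtain ⟨δ, M, hδ, hM, hHall⟩ := exists_holderBounds_allTori d L one_pos (α := 0) le_rfl zero_lt_one
  obtain ⟨MC, δ₀, hMC, hδ₀, HC⟩ := cloc_estimates d L hd
  have hδC : 0 < δ₀ / 2 := half_pos hδ₀
  refine ⟨2, 3 * M ^ 2 * (MC * (Real.exp (4 * δ₀ * L) * (1 + L) ^ 2)) *
      ((d : ℝ) ^ 2 * (Real.exp (min (δ / 2) (δ₀ / 2) / 2 / 2) * ((2 * (1 + d / (min (δ / 2) (δ₀ / 2) / 2))) ^ d) ^ 2)) *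
      ((((d - 2 + 1).factorial : ℝ)) / (min (δ / 2) (δ₀ / 2) / 2) ^ (d - 2 + 1)),
    min (δ / 32) (δ₀ / 2 / 4), min (δ / 2) (δ₀ / 2) / 2 / 2, ?_, ?_, by positivity,
    fun P hPd hPL k hk ρ hρ hmono b b'' hfar => ?_⟩
  · exact lt_min (by positivity) (by positivity)
  · have := lt_min (half_pos hδ) hδC; positivity
  subst hPd; subst hPL
  have hH : ∀ (j : ℕ) (hj : j ≤ P.m + P.K), j < k → ∀ (μ ν : Fin P.d) (x : TSite P 0) (y : TSite P j),
      |(torusRep P j (deltaAData hj 1)).H (x, μ) (y, ν)| ≤ M * Real.exp (-(δ * distEU P j x y)) :=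
    fun j hj _ μ ν x y => (le_add_of_nonneg_right (norm_nonneg _)).trans ((hHall P rfl rfl j hj μ ν y).1 x)
  have hC : ∀ j < k, (∀ b₁ b₂ : PBond P j, |Cmat P j b₁ b₂| ≤
        MC * (Real.exp (4 * δ₀ * P.L) * (1 + P.L) ^ 2) * Real.exp (-(δ₀ / 2 * (supDist b₁.src b₂.src : ℝ)))) ∧
      (∀ b₁ b₂ : PBond P j, |Cloc P j (ρ j / 4) b₁ b₂| ≤
        MC * (Real.exp (4 * δ₀ * P.L) * (1 + P.L) ^ 2) * Real.exp (-(δ₀ / 2 * (supDist b₁.src b₂.src : ℝ)))) ∧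
      (∀ b₁ b₂ : PBond P j, |Cloc P j (ρ j / 4) b₁ b₂ - Cmat P j b₁ b₂| ≤
        MC * (Real.exp (4 * δ₀ * P.L) * (1 + P.L) ^ 2) * Real.exp (-(δ₀ / 2 / 4 * ρ j)) *
          Real.exp (-(δ₀ / 2 * (supDist b₁.src b₂.src : ℝ)))) :=
    fun j hjk => cSide_of_cloc_estimates hMC hδ₀ (fun R b b' => HC P rfl rfl j inferInstance (by omega) R b b') (ρ j)
  rw [neg_mul]
  exact (abs_dk_sub_dkLocPi_le hd hk one_pos hδ hδC hM (by positivity) hH ρ hρ hmono (fun j hjk => (hC j hjk).1)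
    (fun j hjk => (hC j hjk).2.1) (fun j hjk => (hC j hjk).2.2) hfar).trans (le_of_eq (by ring))

/-- **`𝒟^Π_{k,loc}` IS CLOSE TO `𝒟_k` ON THE TORUS — NO HYPOTHESIS AT ALL** (every torus of the series with `d ≥ 2`): `∃ R₀ c₀ c δ′`, `0 < c`,
`0 < δ′`, `0 ≤ c₀`, such that for every `k ≤ m + K`, every radius schedule with `0 < ρ_j`, `ρ_k ≤ ρ_j` (`j < k`), and all `η`-bonds with
`dist_k(b,b″) ≥ R₀`: `|𝒟_k(b,b″) − 𝒟^Π_{k,loc}(b,b″)| ≤ c₀·e^{−cρ_k}·e^{−δ′dist_k(b,b″)}` (the all-tori constants specialised to this torus).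
[cite: BalabanImbrieJaffe1988, (2.13) p.261] -/
theorem close_dkLocPi_dk_torus (hd : 2 ≤ P.d) :
    ∃ R₀ c₀ c δ' : ℝ, 0 < c ∧ 0 < δ' ∧ 0 ≤ c₀ ∧ ∀ (k : ℕ) (_ : k ≤ P.m + P.K) (ρ : ℕ → ℝ),
      (∀ j < k, 0 < ρ j) → (∀ j < k, ρ k ≤ ρ j) → ∀ (b b'' : PBond P 0), R₀ ≤ kdist (P := P) k b b'' →
        |DkE P ((P.eta k) ^ P.d) ((P.L : ℝ) ^ k) k (toE P (Pi.single b'' 1)) b -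
            dkLocKerPi (P := P) ((P.eta k) ^ P.d) ((P.L : ℝ) ^ k) ρ k b b''| ≤
          c₀ * Real.exp (-(c * ρ k)) * Real.exp (-δ' * kdist (P := P) k b b'') := by
  obtain ⟨R₀, c₀, c, δ', hc, hδ', hc₀, H⟩ := close_dkLocPi_dk_allTori (d := P.d) (L := P.L) hd
  exact ⟨R₀, c₀, c, δ', hc, hδ', hc₀, fun k hk ρ hρ hmono b b'' hfar => H P rfl rfl k hk ρ hρ hmono b b'' hfar⟩

/-- **`𝒟^Π_{k,loc}` IS CLOSE TO `𝒟_k` OVER ALL TORI AT THE PRINTED SCHEDULE `ρ_j = r(e_j)` — HYPOTHESIS-FREE** (`2 ≤ d ≤ 4`): ONE `(R₀, c₀, c, δ′)`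
for every torus `P` (`P.d = d`, `P.L = L`), every `k ≤ m + K` with `log e_k⁻¹ > 0` (small charge), every `ε, e > 0`, `r ≥ 0` and all `b, b″`
with `dist_k(b,b″) ≥ R₀`: `|𝒟_k(b,b″) − 𝒟^Π_{k,loc}(b,b″)| ≤ c₀·e^{−c·r(e_k)}·e^{−δ′dist_k(b,b″)}` — the printed uniformity («uniformly in k» and in
the volume) with the printed (2.7)-type smallness `e^{−cr(e_k)}`; the schedule hypotheses from r18 g11's `rSched_pos_of_le`/`rSched_anti`
((2.2)–(2.3): `r(e_j)` positive and non-increasing below `k`). [cite: BalabanImbrieJaffe1988, (2.13) p.261] -/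
theorem close_dkLocPi_dk_allTori_rSched {d L : ℕ} (hd : 2 ≤ d) (hd4 : d ≤ 4) :
    ∃ R₀ c₀ c δ' : ℝ, 0 < c ∧ 0 < δ' ∧ 0 ≤ c₀ ∧ ∀ (P : Params) (_ : P.d = d) (_ : P.L = L) (k : ℕ) (_ : k ≤ P.m + P.K)
      (ε e r : ℝ), 0 < ε → 0 < e → 0 ≤ r → 0 < Real.log (eK (P.L : ℝ) ε e P.d k)⁻¹ →
      ∀ (b b'' : PBond P 0), R₀ ≤ kdist (P := P) k b b'' →
        |DkE P ((P.eta k) ^ P.d) ((P.L : ℝ) ^ k) k (toE P (Pi.single b'' 1)) b -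
            dkLocKerPi (P := P) ((P.eta k) ^ P.d) ((P.L : ℝ) ^ k) (rSched (P.L : ℝ) ε e r P.d) k b b''| ≤
          c₀ * Real.exp (-(c * rSched (P.L : ℝ) ε e r P.d k)) * Real.exp (-δ' * kdist (P := P) k b b'') := by
  obtain ⟨R₀, c₀, c, δ', hc, hδ', hc₀, H⟩ := close_dkLocPi_dk_allTori (d := d) (L := L) hd
  refine ⟨R₀, c₀, c, δ', hc, hδ', hc₀, fun P hPd hPL k hk ε e r hε he hr hℓ b b'' hfar => ?_⟩
  have hL1 : (1 : ℝ) ≤ P.L := by exact_mod_cast P.hL.2.le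
  have hd4' : P.d ≤ 4 := hPd ▸ hd4
  exact H P hPd hPL k hk _ (fun j hj => rSched_pos_of_le hL1 hε he hd4' hj.le hℓ)
    (fun j hj => rSched_anti hL1 hε he hr hd4' hj.le hℓ) b b'' hfar

/-- **`𝒟^Π_{k,loc}` IS CLOSE TO `𝒟_k` ON THE TORUS AT THE PRINTED SCHEDULE** (`2 ≤ d ≤ 4`), NO hypothesis on the kernels: `R₀, c₀ ≥ 0, c > 0, δ′ > 0`
(from `(d, L)`) such that for every `k ≤ m + K` with `log e_k⁻¹ > 0`, every `ε, e > 0`, `r ≥ 0` and all `η`-bonds with `dist_k(b,b″) ≥ R₀`: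
`|𝒟_k(b,b″) − 𝒟^Π_{k,loc}(b,b″)| ≤ c₀·e^{−c·r(e_k)}·e^{−δ′dist_k(b,b″)}`. [cite: BalabanImbrieJaffe1988, (2.13) p.261] -/
theorem close_dkLocPi_dk_torus_rSched (hd : 2 ≤ P.d) (hd4 : P.d ≤ 4) :
    ∃ R₀ c₀ c δ' : ℝ, 0 < c ∧ 0 < δ' ∧ 0 ≤ c₀ ∧ ∀ (k : ℕ) (_ : k ≤ P.m + P.K) (ε e r : ℝ), 0 < ε → 0 < e → 0 ≤ r →
      0 < Real.log (eK (P.L : ℝ) ε e P.d k)⁻¹ → ∀ (b b'' : PBond P 0), R₀ ≤ kdist (P := P) k b b'' →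
        |DkE P ((P.eta k) ^ P.d) ((P.L : ℝ) ^ k) k (toE P (Pi.single b'' 1)) b -
            dkLocKerPi (P := P) ((P.eta k) ^ P.d) ((P.L : ℝ) ^ k) (rSched (P.L : ℝ) ε e r P.d) k b b''| ≤
          c₀ * Real.exp (-(c * rSched (P.L : ℝ) ε e r P.d k)) * Real.exp (-δ' * kdist (P := P) k b b'') := by
  obtain ⟨R₀, c₀, c, δ', hc, hδ', hc₀, H⟩ := close_dkLocPi_dk_allTori_rSched (d := P.d) (L := P.L) hd hd4
  exact ⟨R₀, c₀, c, δ', hc, hδ', hc₀, fun k hk ε e r hε he hr hℓ b b'' hfar => H P rfl rfl k hk ε e r hε he hr hℓ b b'' hfar⟩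

end

end Literature.MathematicalPhysics.QuantumFieldTheory.BalabanImbrieJaffe1984to88.BIJ88CurlyDkLocPiCloseTorus
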